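import Mathlib
import HarnessLib

/-!
# Crux `MobiusLadder.LiouvilleOrthogonalTC0` (stmt-QuantumAdvantage-1393), line `Sketch`, skeleton v8:
stub `stub_sliceL2` (K3a) — discrete Parseval on the Hamming slices
-/

set_option linter.dupNamespace false -- D-0017: single-problem summit ⇒ `QuantumAdvantage.QuantumAdvantage` by design

noncomputable section

namespace Summit.QuantumAdvantage.QuantumAdvantage.Theorems.LiouvilleOrthogonalTC0

open Filter Finset

/-- The additive character at frequency `k/(n+1)` evaluated at a natural weight `m` is the
`(k*m)`-th power of the standard primitive `(n+1)`-th root of unity `exp (2πi/(n+1))`. -/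
theorem sliceL2_exp_eq_pow (n k m : ℕ) :
    Complex.exp ((((2 * Real.pi * ((k : ℝ) / (n + 1)) * (m : ℝ)) : ℝ) : ℂ) * Complex.I)
      = Complex.exp (2 * Real.pi * Complex.I / ((n + 1 : ℕ) : ℂ)) ^ (k * m) := by
  rw [← Complex.exp_nat_mul]
  congr 1
  push_cast
  ring

/-- Orthogonality of the characters of `ℤ/Mℤ`: for a primitive `M`-th root of unity `ζ : ℂ` and
exponents `j, j' < M`, the sum `∑_{k<M} ζ^{kj} · conj(ζ)^{kj'}` equals `M` if `j = j'` and `0`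
otherwise. -/
theorem sliceL2_orth {M : ℕ} {ζ : ℂ} (hζ : IsPrimitiveRoot ζ M) {j j' : ℕ} (hj : j < M)
    (hj' : j' < M) :
    ∑ k ∈ Finset.range M, ζ ^ (k * j) * (starRingEnd ℂ) ζ ^ (k * j')
      = if j = j' then (M : ℂ) else 0 := by
  have hM : M ≠ 0 := by omega
  have hζ0 : ζ ≠ 0 := hζ.ne_zero hM
  have hconj : (starRingEnd ℂ) ζ = ζ⁻¹ := (Complex.inv_eq_conj (hζ.norm'_eq_one hM)).symm
  have hterm : ∀ k : ℕ,
      ζ ^ (k * j) * (starRingEnd ℂ) ζ ^ (k * j') = (ζ ^ j * (ζ ^ j')⁻¹) ^ k := by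
    intro k
    rw [hconj, mul_pow, ← pow_mul', ← inv_pow, ← pow_mul']
  simp_rw [hterm]
  split_ifs with h
  · subst h
    rw [mul_inv_cancel₀ (pow_ne_zero _ hζ0)]
    simp
  · have hx : ζ ^ j * (ζ ^ j')⁻¹ ≠ 1 := by
      intro hx
      rw [mul_inv_eq_one₀ (pow_ne_zero _ hζ0)] at hx
      exact h (hζ.pow_inj hj hj' hx)
    have h1 : ∀ i : ℕ, (ζ ^ i) ^ M = 1 := fun i => by
      rw [← pow_mul, mul_comm, pow_mul, hζ.pow_eq_one, one_pow]
    have hxM : (ζ ^ j * (ζ ^ j')⁻¹) ^ M = 1 := by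
      rw [mul_pow, inv_pow, h1, h1, inv_one, mul_one]
    rw [geom_sum_eq hx, hxM, sub_self, zero_div]

/-- Discrete Parseval (Plancherel) identity for the length-`M` Fourier transform of a real
vector: for a primitive `M`-th root of unity `ζ`,
`∑_{k<M} ‖∑_{j<M} A_j ζ^{kj}‖² = M · ∑_{j<M} A_j²`. -/
theorem sliceL2_parseval (M : ℕ) {ζ : ℂ} (hζ : IsPrimitiveRoot ζ M) (A : ℕ → ℝ) :
    ∑ k ∈ Finset.range M, ‖∑ j ∈ Finset.range M, (A j : ℂ) * ζ ^ (k * j)‖ ^ 2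
      = (M : ℝ) * ∑ j ∈ Finset.range M, A j ^ 2 := by
  apply Complex.ofReal_injective
  push_cast
  simp_rw [← Complex.mul_conj', map_sum, Finset.sum_mul_sum, map_mul, Complex.conj_ofReal,
    map_pow]
  calc
    _ = ∑ j ∈ Finset.range M, ∑ j' ∈ Finset.range M, (A j : ℂ) * (A j' : ℂ) *
          ∑ k ∈ Finset.range M, ζ ^ (k * j) * (starRingEnd ℂ) ζ ^ (k * j') := by
        rw [Finset.sum_comm]
        refine Finset.sum_congr rfl fun j _ => ?_
        rw [Finset.sum_comm]
        refine Finset.sum_congr rfl fun j' _ => ?_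
        rw [Finset.mul_sum]
        refine Finset.sum_congr rfl fun k _ => ?_
        ring
    _ = ∑ j ∈ Finset.range M, ∑ j' ∈ Finset.range M, (A j : ℂ) * (A j' : ℂ) *
          (if j = j' then (M : ℂ) else 0) := by
        refine Finset.sum_congr rfl fun j hj => Finset.sum_congr rfl fun j' hj' => ?_
        rw [sliceL2_orth hζ (Finset.mem_range.1 hj) (Finset.mem_range.1 hj')]
    _ = (M : ℂ) * ∑ j ∈ Finset.range M, (A j : ℂ) ^ 2 := by
        rw [Finset.mul_sum]
        refine Finset.sum_congr rfl fun j hj => ?_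
        simp_rw [mul_ite, mul_zero]
        rw [Finset.sum_ite_eq, if_pos hj]
        ring

/-- Discrete Parseval on weight slices, general form (with equality): for an integer sequence
`g`, a weight `w` with `w N ≤ n` on `S`, and slice sums `A_j = ∑_{N ∈ S, w N = j} g N`, one has
`∑_{j ≤ n} A_j² = (n+1)⁻¹ · ∑_{k ≤ n} ‖∑_{N ∈ S} g(N) e(k · w(N)/(n+1))‖²`. -/
theorem sliceL2_general (n : ℕ) (S : Finset ℕ) (g : ℕ → ℤ) (w : ℕ → ℕ)
    (hw : ∀ N ∈ S, w N < n + 1) :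
    ∑ j ∈ Finset.range (n + 1), (∑ N ∈ S.filter (fun N => w N = j), ((g N : ℤ) : ℝ)) ^ 2
      = (∑ k ∈ Finset.range (n + 1),
          ‖∑ N ∈ S, ((g N : ℤ) : ℂ) *
            Complex.exp (((2 * Real.pi * ((k : ℝ) / (n + 1)) * (w N : ℝ) : ℝ) : ℂ) * Complex.I)‖ ^ 2)
          / (n + 1) := by
  have hζ : IsPrimitiveRoot (Complex.exp (2 * Real.pi * Complex.I / ((n + 1 : ℕ) : ℂ))) (n + 1) :=
    Complex.isPrimitiveRoot_exp (n + 1) (Nat.succ_ne_zero n)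
  have hw' : ∀ N ∈ S, w N ∈ Finset.range (n + 1) := fun N hN => Finset.mem_range.2 (hw N hN)
  have hT : ∀ k : ℕ, ∑ N ∈ S, ((g N : ℤ) : ℂ) *
        Complex.exp (((2 * Real.pi * ((k : ℝ) / (n + 1)) * (w N : ℝ) : ℝ) : ℂ) * Complex.I)
      = ∑ j ∈ Finset.range (n + 1),
          ((∑ N ∈ S.filter (fun N => w N = j), ((g N : ℤ) : ℝ) : ℝ) : ℂ) *
            Complex.exp (2 * Real.pi * Complex.I / ((n + 1 : ℕ) : ℂ)) ^ (k * j) := by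
    intro k
    rw [← Finset.sum_fiberwise_of_maps_to hw']
    refine Finset.sum_congr rfl fun j _ => ?_
    rw [Complex.ofReal_sum, Finset.sum_mul]
    refine Finset.sum_congr rfl fun N hN => ?_
    rw [Complex.ofReal_intCast, sliceL2_exp_eq_pow, (Finset.mem_filter.1 hN).2]
  simp_rw [hT]
  rw [sliceL2_parseval (n + 1) hζ, eq_div_iff (by positivity)]
  push_cast
  ring

/-- **Discrete Parseval on the Hamming-weight slices (K3a).** With the slice sums
`A_j := ∑_{N < 2ⁿ, s₂(N) = j} λ(N)` (where `s₂(N)` is the number of `1`s among the `n` low binary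
digits of `N` and `λ` is the Liouville function) and the Gelfond-type sums
`S(θ) := ∑_{N < 2ⁿ} λ(N) e(θ · s₂(N))` at the `n+1` frequencies `θ_k = k/(n+1)`, one has
`∑_{j ≤ n} A_j² ≤ (n+1)⁻¹ ∑_{k ≤ n} |S(θ_k)|²` (in fact with equality: orthogonality of the
characters of `ℤ/(n+1)ℤ`, since all weights lie in `{0, …, n}`). -/
theorem stub_sliceL2 (n : ℕ) :
    ∑ j ∈ Finset.range (n + 1),
        (∑ N ∈ (Finset.range (2 ^ n)).filter
            (fun N => (Finset.univ.filter fun i : Fin n => Nat.testBit N i = true).card = j),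
          ((ArithmeticFunction.liouville N : ℤ) : ℝ)) ^ 2
      ≤ (∑ k ∈ Finset.range (n + 1),
          ‖∑ N ∈ Finset.range (2 ^ n), ((ArithmeticFunction.liouville N : ℤ) : ℂ) *
            Complex.exp (((2 * Real.pi * ((k : ℝ) / (n + 1)) *
              ((Finset.univ.filter fun i : Fin n => Nat.testBit N i = true).card : ℝ) : ℝ) : ℂ) * Complex.I)‖ ^ 2) / (n + 1) := by
  have hw : ∀ N ∈ Finset.range (2 ^ n),
      (Finset.univ.filter fun i : Fin n => Nat.testBit N i = true).card < n + 1 := by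
    intro N _
    calc (Finset.univ.filter fun i : Fin n => Nat.testBit N i = true).card
        ≤ (Finset.univ : Finset (Fin n)).card := Finset.card_filter_le _ _
      _ = n := by simp
      _ < n + 1 := n.lt_succ_self
  exact (sliceL2_general n (Finset.range (2 ^ n)) (fun N => ArithmeticFunction.liouville N)
    (fun N => (Finset.univ.filter fun i : Fin n => Nat.testBit N i = true).card) hw).le

end Summit.QuantumAdvantage.QuantumAdvantage.Theorems.LiouvilleOrthogonalTC0
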